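import Mathlib
import Literature.NumberTheory.Automorphic.ClozelAlgebraicity
import Literature.NumberTheory.Automorphic.ClozelAlgebraicityRatFieldProofs
import Literature.NumberTheory.Automorphic.ClozelAlgebraicityConjugatesProofs
import Literature.NumberTheory.Automorphic.ClozelAlgebraicityHeckeFieldProofs
import Literature.NumberTheory.Automorphic.AutomorphicRepsGLSatakeFlathProofs
import Literature.FieldTheory.AlgClosed.AutomorphismExtension
import Literature.NumberTheory.GaloisRepresentations.ArtinRestriction
import Summits.Langlands.Langlands.Theses.IrreducibilityBySelfDuality

/-!
# Sketch for crux idea `baire-uniform-exceptional-set` (crux `HeckeEigenvalueField`, stmt-Langlands-13632)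

Lever: Baire category on the compact group `Gal(ℚ̄/ℚ)` uniformizes the σ-dependent exceptional
sets of `IsAutConjugate`; the crux then follows from clause (ii) of `Clozel1990_regularAlgebraic`
(existence of regular algebraic cuspidal `Aut(ℂ)`-conjugates at almost all places), countability of
the eigen-germs of regular algebraic cuspidal representations (Harish-Chandra finiteness, proved in
tree) and Satake uniqueness (proved in tree).
-/

open scoped Pointwise Classical
open Filter Set

-- Mathlib idiom used by every automorphic carrier file (Lie subalgebras of matrix algebras)
attribute [local instance 100] LieRing.ofAssociativeRing

set_option linter.dupNamespace false

namespace Summit.Langlands.Langlands.Cruxes.HeckeEigenvalueField.BaireSketch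

/-! ## S2 — the Baire lemma (PROVED here) -/

/-- **Baire uniformization.** In a compact Hausdorff group, if a subgroup `H` of countable index is
the union of an increasing-or-not countable family of CLOSED subgroups `K m ≤ H`, then some `K m`
is open (hence of finite index). -/
theorem exists_isOpen_of_countable_index
    {G : Type*} [Group G] [TopologicalSpace G] [IsTopologicalGroup G] [CompactSpace G] [T2Space G]
    (K : ℕ → Subgroup G) (hK : ∀ m, IsClosed (K m : Set G)) (H : Subgroup G)
    (hcov : ∀ h ∈ H, ∃ m, h ∈ K m) [Countable (G ⧸ H)] :
    ∃ m, IsOpen (K m : Set G) := by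
  classical
  let f : (G ⧸ H) × ℕ → Set G := fun p => p.1.out • (K p.2 : Set G)
  have hclosed : ∀ p, IsClosed (f p) := fun p => (hK p.2).smul _
  have hcover : ⋃ p, f p = Set.univ := by
    refine Set.eq_univ_of_forall fun g => ?_
    have hmem : (QuotientGroup.mk g : G ⧸ H).out⁻¹ * g ∈ H := by
      rw [← QuotientGroup.eq, QuotientGroup.out_eq']
    obtain ⟨m, hm⟩ := hcov _ hmem
    refine Set.mem_iUnion.2 ⟨((QuotientGroup.mk g : G ⧸ H), m), ?_⟩
    refine Set.mem_smul_set.2 ⟨_, hm, ?_⟩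
    simp [smul_eq_mul, mul_inv_cancel_left]
  obtain ⟨p, x, hx⟩ := nonempty_interior_of_iUnion_of_closed hclosed hcover
  refine ⟨p.2, (K p.2).isOpen_of_mem_nhds (g := p.1.out⁻¹ • x) ?_⟩
  rw [← mem_interior_iff_mem_nhds]
  have hx' : x ∈ p.1.out • interior (K p.2 : Set G) := by
    rwa [← interior_smul]
  exact Set.mem_smul_set_iff_inv_smul_mem.1 hx'

/-! ## S3 — homogeneity of `ℂ`: one automorphism moves every transcendental entry off a countable field
(statement; generalises `Complex.exists_ringEquiv_fix_apply_ne` of `AutFixedSubfield`) -/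

/-- **(S3)** For a countable subfield `M ⊆ ℂ` and a countable family `a`, one automorphism of `ℂ`
moves every transcendental `a v` outside `M` (proof line: send a transcendence basis of
`ℚ(a v : v)` to a set algebraically independent over `M`, extend by `IsAlgClosed.lift` and
`Literature.FieldTheory.AlgClosed.exists_ringEquiv_apply_eq`). -/
def MovesTranscendentalsOff : Prop :=
  ∀ (M : Subfield ℂ), Cardinal.mk M ≤ Cardinal.aleph0 →
    ∀ {ι : Type} [Countable ι] (a : ι → ℂ),
      ∃ σ : ℂ ≃ₐ[ℚ] ℂ, ∀ v, Transcendental ℚ (a v) → σ (a v) ∉ M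

/-! ## UNIF — the uniformization theorem (statement): countable `Aut(ℂ)`-orbit of the germ ⇒ one number field -/

/-- **(UNIF)** If the germ (modulo finite sets) of a countable family `a : ι → ℂ` has a COUNTABLE
orbit under `Aut(ℂ) = (ℂ ≃ₐ[ℚ] ℂ)` — every conjugate family `σ ∘ a` agrees off a (σ-dependent!)
finite set with a member of a fixed countable set `𝒞` — then all but finitely many `a v` lie in ONE
subfield of `ℂ` finite over `ℚ`. Proof line: (S3) ⇒ finitely many transcendental entries;
restriction `Aut(ℂ) → Gal(ℚ̄/ℚ)` is surjective (`exists_ringEquiv_apply_eq`), the germ stabiliser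
in `Gal(ℚ̄/ℚ)` has countable index and is `⋃_F ⋂_{v ∉ F} Stab(a v)`; (S2) ⇒ some
`⋂_{v ∉ F} Stab(a v)` is open ⇒ its fixed field is a number field
(`finiteDimensional_fixedField_of_isOpen`) containing `a v`, `v ∉ F`. -/
def UniformOfCountableAutOrbit : Prop :=
  ∀ {ι : Type} [Countable ι] (a : ι → ℂ) (𝒞 : Set (ι → ℂ)), 𝒞.Countable →
    (∀ σ : ℂ ≃ₐ[ℚ] ℂ, ∃ c ∈ 𝒞, ∀ᶠ v in cofinite, σ (a v) = c v) →
    ∃ E : Subfield ℂ, FiniteDimensional ℚ E ∧ ∀ᶠ v in cofinite, a v ∈ E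

/-! ## UNIF proved from (S2) + (S3) + homogeneity of `ℂ` (in tree) -/

section UNIFProof

open Polynomial Cardinal

-- the two `ℚ`-algebra structures on `AlgebraicClosure ℚ` (`DivisionRing.toRatAlgebra`,
-- `AlgebraicClosure.instAlgebra`) are defeq but not reducibly; register the facts we need
instance instIsAlgebraicQbar : Algebra.IsAlgebraic ℚ (AlgebraicClosure ℚ) :=
  AlgebraicClosure.isAlgebraic ℚ
instance instIsAlgClosureQbar : IsAlgClosure ℚ (AlgebraicClosure ℚ) :=
  AlgebraicClosure.instIsAlgClosure ℚ
instance instIsGaloisQbar : IsGalois ℚ (AlgebraicClosure ℚ) := IsAlgClosure.isGalois ℚ _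

local notation "Γℚ" => (AlgebraicClosure ℚ ≃ₐ[ℚ] AlgebraicClosure ℚ)

example : CompactSpace Γℚ := inferInstance
example : T2Space Γℚ := inferInstance
example : IsTopologicalGroup Γℚ := inferInstance

/-- Open subgroups of `Gal(ℚ̄/ℚ)` have number fields as fixed fields (Krull). -/
theorem finiteDimensional_fixedField_of_isOpen_gal (H : Subgroup Γℚ) (hH : IsOpen (H : Set Γℚ)) :
    FiniteDimensional ℚ (IntermediateField.fixedField H) := by
  rw [← InfiniteGalois.isOpen_iff_finite]
  have h : (IntermediateField.fixedField H).fixingSubgroup = H :=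
    InfiniteGalois.fixingSubgroup_fixedField ⟨H, H.isClosed_of_isOpen hH⟩
  rw [h]
  exact hH

/-- A fixed `ℚ`-embedding `ℚ̄ → ℂ`. -/
noncomputable def jEmb : AlgebraicClosure ℚ →ₐ[ℚ] ℂ := IsAlgClosed.lift

/-- Every algebraic complex number is in the image of `ℚ̄`. -/
theorem exists_jEmb_eq {x : ℂ} (hx : IsAlgebraic ℚ x) : ∃ b : AlgebraicClosure ℚ, jEmb b = x := by
  have hint : IsIntegral ℚ x := hx.isIntegral
  set p : (AlgebraicClosure ℚ)[X] := (minpoly ℚ x).map (algebraMap ℚ (AlgebraicClosure ℚ)) with hp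
  have hsplit : p.Splits := IsAlgClosed.splits p
  have hroots : p.roots.map jEmb.toRingHom = (p.map jEmb.toRingHom).roots :=
    roots_map_of_injective_of_card_eq_natDegree jEmb.toRingHom.injective
      (splits_iff_card_roots.1 hsplit)
  have hmap : p.map jEmb.toRingHom = (minpoly ℚ x).map (algebraMap ℚ ℂ) := by
    rw [hp, Polynomial.map_map]
    congr 1
    exact jEmb.comp_algebraMap
  have hx0 : ((minpoly ℚ x).map (algebraMap ℚ ℂ)) ≠ 0 :=
    Polynomial.map_ne_zero (minpoly.ne_zero hint)
  have hxroot : x ∈ ((minpoly ℚ x).map (algebraMap ℚ ℂ)).roots := by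
    rw [Polynomial.mem_roots hx0, IsRoot.def, eval_map, ← aeval_def, minpoly.aeval]
  rw [← hmap, ← hroots, Multiset.mem_map] at hxroot
  obtain ⟨b, -, hb⟩ := hxroot
  exact ⟨b, hb⟩

/-- **Restriction `Aut(ℂ) → Gal(ℚ̄/ℚ)` is surjective** (homogeneity of `ℂ`,
`Literature.FieldTheory.AlgClosed.exists_ringEquiv_apply_eq`). -/
theorem exists_aut_extending (τ : Γℚ) :
    ∃ σ : ℂ ≃ₐ[ℚ] ℂ, ∀ b, σ (jEmb b) = jEmb (τ b) := by
  have hQ : #(AlgebraicClosure ℚ) ≤ ℵ₀ := by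
    refine (Algebra.IsAlgebraic.cardinalMk_le_max ℚ (AlgebraicClosure ℚ)).trans ?_
    rw [Cardinal.mk_eq_aleph0 ℚ, max_self]
  have hC : ℵ₀ < #ℂ := by
    rw [Cardinal.mk_complex]
    exact Cardinal.aleph0_lt_continuum
  obtain ⟨σ, hσ⟩ := Literature.FieldTheory.AlgClosed.exists_ringEquiv_apply_eq hC hQ
    jEmb.toRingHom (jEmb.toRingHom.comp τ.toAlgHom.toRingHom)
  refine ⟨AlgEquiv.ofRingEquiv (f := σ) fun q => ?_, fun b => hσ b⟩
  rw [Algebra.algebraMap_eq_smul_one, map_rat_smul, map_one]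

/-- **(UNIF) holds given (S3).** Baire category on `Gal(ℚ̄/ℚ)` uniformizes the exceptional sets. -/
theorem uniformOfCountableAutOrbit (hS3 : MovesTranscendentalsOff) : UniformOfCountableAutOrbit := by
  intro ι _ a 𝒞 h𝒞 horbit
  classical
  -- Step 1: only finitely many entries are transcendental
  let V : Set ℂ := ⋃ c ∈ 𝒞, Set.range c
  have hV : V.Countable := h𝒞.biUnion fun c _ => Set.countable_range c
  let M : Subfield ℂ := Subfield.closure V
  have hM : #M ≤ ℵ₀ := by
    refine (Subfield.cardinalMk_closure_le_max V).trans ?_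
    exact max_le (Cardinal.le_aleph0_iff_set_countable.2 hV) le_rfl
  obtain ⟨σ₀, hσ₀⟩ := hS3 M hM a
  obtain ⟨c₀, hc₀, hc₀'⟩ := horbit σ₀
  have halg : ∀ᶠ v in cofinite, IsAlgebraic ℚ (a v) := by
    filter_upwards [hc₀'] with v hv
    by_contra htr
    apply hσ₀ v htr
    rw [hv]
    exact Subfield.subset_closure (Set.mem_biUnion hc₀ ⟨v, rfl⟩)
  -- Step 2: algebraic entries come from `ℚ̄`
  have hpre : ∀ᶠ v in cofinite, ∃ b : AlgebraicClosure ℚ, jEmb b = a v := by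
    filter_upwards [halg] with v hv using exists_jEmb_eq hv
  let b : ι → AlgebraicClosure ℚ := fun v =>
    if h : ∃ b : AlgebraicClosure ℚ, jEmb b = a v then h.choose else 0
  have hb : ∀ᶠ v in cofinite, jEmb (b v) = a v := by
    filter_upwards [hpre] with v hv
    simp only [b, dif_pos hv]
    exact hv.choose_spec
  -- Step 3: pointwise stabilisers off finite sets (closed subgroups of `Gal(ℚ̄/ℚ)`)
  let Kst : Finset ι → Subgroup Γℚ := fun F =>
    ⨅ (v : ι) (_ : v ∉ F), MulAction.stabilizer Γℚ (b v)
  have hKst_mem : ∀ F (τ : Γℚ), τ ∈ Kst F ↔ ∀ v ∉ F, τ (b v) = b v := by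
    intro F τ
    simp only [Kst, Subgroup.mem_iInf, MulAction.mem_stabilizer_iff, AlgEquiv.smul_def]
  have hKst_closed : ∀ F, IsClosed (Kst F : Set Γℚ) := by
    intro F
    simp only [Kst, Subgroup.coe_iInf]
    refine isClosed_iInter fun v => isClosed_iInter fun _ => ?_
    apply Subgroup.isClosed_of_isOpen
    haveI : FiniteDimensional ℚ (IntermediateField.adjoin ℚ {b v}) :=
      IntermediateField.adjoin.finiteDimensional (Algebra.IsIntegral.isIntegral (b v))
    apply Subgroup.isOpen_mono (H₁ := (IntermediateField.adjoin ℚ {b v}).fixingSubgroup)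
    · intro τ hτ
      rw [MulAction.mem_stabilizer_iff, AlgEquiv.smul_def]
      exact (IntermediateField.mem_fixingSubgroup_iff _ _).1 hτ _
        (IntermediateField.mem_adjoin_simple_self ℚ (b v))
    · exact IntermediateField.fixingSubgroup_isOpen _
  -- the germ stabiliser
  let H : Subgroup Γℚ :=
    { carrier := {τ | ∀ᶠ v in cofinite, τ (b v) = b v}
      one_mem' := by
        change ∀ᶠ v in cofinite, _
        exact Filter.Eventually.of_forall fun _ => rfl
      mul_mem' := fun {σ τ} hσ hτ => by
        change ∀ᶠ v in cofinite, _ at hσ hτ ⊢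
        filter_upwards [hσ, hτ] with v h1 h2
        rw [AlgEquiv.mul_apply, h2, h1]
      inv_mem' := fun {σ} hσ => by
        change ∀ᶠ v in cofinite, _ at hσ ⊢
        filter_upwards [hσ] with v h1
        conv_lhs => rw [← h1]
        exact σ.symm_apply_apply _ }
  -- enumerate the finite subsets of `ι`; `H` is covered by the `Kst (e m)`
  obtain ⟨e, he⟩ := exists_surjective_nat (Finset ι)
  have hcov : ∀ τ ∈ H, ∃ m, τ ∈ Kst (e m) := by
    intro τ hτ
    have hτ' : ∀ᶠ v in cofinite, τ (b v) = b v := hτ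
    have hfin : {v | ¬ τ (b v) = b v}.Finite := Filter.eventually_cofinite.1 hτ'
    obtain ⟨m, hm⟩ := he hfin.toFinset
    refine ⟨m, (hKst_mem _ _).2 fun v hv => ?_⟩
    by_contra hne
    apply hv
    rw [hm, Set.Finite.mem_toFinset]
    exact hne
  -- Step 4: the index of `H` is countable (each coset is pinned by a member of `𝒞`)
  choose σ hσ using fun τ : Γℚ => exists_aut_extending τ
  choose c hc𝒞 hcτ using fun τ : Γℚ => horbit (σ τ)
  have key : ∀ τ τ' : Γℚ, c τ = c τ' →
      (QuotientGroup.mk τ : Γℚ ⧸ H) = QuotientGroup.mk τ' := by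
    intro τ τ' h
    rw [QuotientGroup.eq]
    show ∀ᶠ v in cofinite, (τ⁻¹ * τ') (b v) = b v
    filter_upwards [hcτ τ, hcτ τ', hb] with v h1 h2 h3
    have h4 : jEmb (τ (b v)) = jEmb (τ' (b v)) := by
      rw [← hσ τ, ← hσ τ', h3, h1, h2, h]
    have h5 : τ (b v) = τ' (b v) := jEmb.toRingHom.injective h4
    rw [AlgEquiv.mul_apply, ← h5]
    exact τ.symm_apply_apply _
  haveI : Countable 𝒞 := h𝒞.to_subtype
  haveI : Countable (Γℚ ⧸ H) := by
    let g : 𝒞 → Γℚ ⧸ H := fun s =>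
      if h : ∃ τ, c τ = s.1 then QuotientGroup.mk h.choose else QuotientGroup.mk 1
    have hg : Function.Surjective g := by
      intro q
      induction q using QuotientGroup.induction_on with
      | H τ =>
        refine ⟨⟨c τ, hc𝒞 τ⟩, ?_⟩
        have h : ∃ τ', c τ' = c τ := ⟨τ, rfl⟩
        simp only [g, dif_pos h]
        exact key _ _ h.choose_spec
    exact hg.countable
  -- Step 5: Baire
  obtain ⟨m, hm⟩ := exists_isOpen_of_countable_index (fun m => Kst (e m)) (fun m => hKst_closed _) H hcov
  haveI hfd : FiniteDimensional ℚ (IntermediateField.fixedField (Kst (e m))) :=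
    finiteDimensional_fixedField_of_isOpen_gal (Kst (e m)) hm
  have hbE' : ∀ v ∉ e m, b v ∈ IntermediateField.fixedField (Kst (e m)) := by
    intro v hv
    rw [IntermediateField.mem_fixedField_iff]
    intro τ hτ
    exact (hKst_mem _ _).1 hτ v hv
  set L : IntermediateField ℚ ℂ := (IntermediateField.fixedField (Kst (e m))).map jEmb with hL
  haveI : FiniteDimensional ℚ L :=
    LinearEquiv.finiteDimensional
      (IntermediateField.equivMap (IntermediateField.fixedField (Kst (e m))) jEmb).toLinearEquiv
  obtain ⟨E, hE, hiff⟩ := Literature.LinearAlgebra.BaseChange.exists_subfield_finiteDimensional_iff_mem L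
  refine ⟨E, hE, ?_⟩
  have hfin : {v : ι | ¬ v ∉ e m}.Finite :=
    (e m).finite_toSet.subset fun v (hv : ¬ v ∉ e m) => not_not.1 hv
  filter_upwards [hb, Filter.eventually_cofinite.2 hfin] with v h1 h2
  rw [hiff, ← h1, hL, IntermediateField.mem_map]
  exact ⟨b v, hbE' v h2, rfl⟩

end UNIFProof

/-! ## S4 — countability of the eigen-germs of regular algebraic cuspidal representations (statement) -/

section Automorphic

open Literature.NumberTheory.Automorphic NumberField IsDedekindDomain

variable {n : ℕ} {K : Type} [Field K] [NumberField K] {hcpt : isCompact_glFiniteIntegralLevel n K}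

/-- The unramified Hecke eigensystem of `π` as a genuine function (`0` where ramified); by
`hasSatakeParamAt_unique_holds` it agrees with `heckeEigenvalueOf n v α i` at every Satake
parameter `α` of `π` at `v`. -/
noncomputable def eigensystem (π : AutomorphicRepData (AutomorphyDatum.gl n K hcpt)) :
    HeightOneSpectrum (𝓞 K) × Fin (n + 1) → ℂ := fun p =>
  if h : π.IsUnramifiedAt p.1 then heckeEigenvalueOf n p.1 (Classical.choose h) p.2 else 0

variable (n K hcpt) in
/-- **(S4)** The germs (mod finite sets of places) of the unramified Hecke eigensystems of the
REGULAR ALGEBRAIC cuspidal `π` on `GL_n(𝔸_K)` form a countable set: countably many levels `K(𝔫)`,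
countably many regular algebraic infinity types, and for each (level, `Z(𝔤)`-ideal `(ker θ_T)^N`,
finite set of `K_∞`-types) a finite-dimensional Hecke-stable space of cusp forms
(`harishChandra_finiteness_holds`, ideal form) carrying finitely many simultaneous eigencharacters. -/
def CountableRegularAlgebraicGerms : Prop :=
  Set.Countable ((fun π : CuspidalAutomorphicRepData n K hcpt =>
      ((eigensystem π.1 : HeightOneSpectrum (𝓞 K) × Fin (n + 1) → ℂ) :
        Germ (cofinite : Filter (HeightOneSpectrum (𝓞 K) × Fin (n + 1))) ℂ)) ''
    {π | π.1.IsRegularAlgebraic})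

/-- **Clause (ii) of `Clozel1990_regularAlgebraic`, isolated** (the only part of Clozel's package
the line consumes): regular algebraic cuspidal `Aut(ℂ)`-conjugates exist at almost all places. -/
def RegularAlgebraicAutConjugatesExist : Prop :=
  ∀ (n : ℕ) (K : Type) [Field K] [NumberField K] (hcpt : isCompact_glFiniteIntegralLevel n K)
    (π : CuspidalAutomorphicRepData n K hcpt), π.1.IsRegularAlgebraic → ∀ σ : ℂ ≃ₐ[ℚ] ℂ,
      ∃ π' : CuspidalAutomorphicRepData n K hcpt, IsAutConjugate σ π.1 π'.1 ∧ π'.1.IsRegularAlgebraic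

/-- Clause (ii) is implied by the vendored fact (proved in tree:
`Clozel1990_regularAlgebraic.exists_isAutConjugate_isRegularAlgebraic`). -/
theorem regularAlgebraicAutConjugatesExist_of_fact (h : Clozel1990_regularAlgebraic) :
    RegularAlgebraicAutConjugatesExist :=
  fun _ _ _ _ _ π hπ σ => h.exists_isAutConjugate_isRegularAlgebraic π hπ σ

/-- **First lemma of the line (signature).** The crux from: (UNIF) + (S4 for every `n, K`) +
clause (ii). -/
def CruxOfConjugates : Prop :=
  UniformOfCountableAutOrbit →
    (∀ (n : ℕ) (K : Type) [Field K] [NumberField K] (hcpt : isCompact_glFiniteIntegralLevel n K),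
      CountableRegularAlgebraicGerms n K hcpt) →
    RegularAlgebraicAutConjugatesExist →
    Summit.Langlands.Langlands.Theses.IrreducibilityBySelfDuality.HeckeEigenvalueField

/-- The eigensystem function reads the (unique) Satake parameter. -/
theorem eigensystem_eq_of_hasSatakeParamAt (π : AutomorphicRepData (AutomorphyDatum.gl n K hcpt))
    {v : HeightOneSpectrum (𝓞 K)} {α : Multiset ℂ} (hα : π.HasSatakeParamAt v α) (i : Fin (n + 1)) :
    eigensystem π (v, i) = heckeEigenvalueOf n v α i := by
  have h : π.IsUnramifiedAt v := ⟨α, hα⟩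
  show (if h : π.IsUnramifiedAt v then heckeEigenvalueOf n v (Classical.choose h) i else 0) = _
  rw [dif_pos h]
  congr 1
  exact AutomorphicRepData.hasSatakeParamAt_unique_holds π (Classical.choose_spec h) hα

/-- **The reduction, kernel-checked**: (UNIF) + (S4) + clause (ii) ⟹ the crux. -/
theorem cruxOfConjugates : CruxOfConjugates := by
  intro hU hC hA n K _ _ hcpt π hπ
  haveI : Countable (HeightOneSpectrum (𝓞 K)) := countable_heightOneSpectrum K
  -- the countable set of germ representatives of regular algebraic cuspidal eigensystems
  set S : Set (Germ (cofinite : Filter (HeightOneSpectrum (𝓞 K) × Fin (n + 1))) ℂ) :=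
    (fun π' : CuspidalAutomorphicRepData n K hcpt =>
      ((eigensystem π'.1 : HeightOneSpectrum (𝓞 K) × Fin (n + 1) → ℂ) :
        Germ (cofinite : Filter (HeightOneSpectrum (𝓞 K) × Fin (n + 1))) ℂ)) ''
    {π' | π'.1.IsRegularAlgebraic} with hS_def
  have hS : S.Countable := hC n K hcpt
  let 𝒞 : Set (HeightOneSpectrum (𝓞 K) × Fin (n + 1) → ℂ) :=
    (fun γ : Germ (cofinite : Filter (HeightOneSpectrum (𝓞 K) × Fin (n + 1))) ℂ =>
      (Quotient.out γ : HeightOneSpectrum (𝓞 K) × Fin (n + 1) → ℂ)) '' S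
  have h𝒞 : 𝒞.Countable := hS.image _
  -- clause (ii) + Satake uniqueness: the orbit of the eigensystem of `π` lies in `𝒞` modulo finite sets
  have horbit : ∀ σ : ℂ ≃ₐ[ℚ] ℂ, ∃ c ∈ 𝒞, ∀ᶠ p in cofinite, σ (eigensystem π.1 p) = c p := by
    intro σ
    obtain ⟨π', hconj, hπ'⟩ := hA n K hcpt π hπ σ
    have hγ : ((eigensystem π'.1 : HeightOneSpectrum (𝓞 K) × Fin (n + 1) → ℂ) :
        Germ (cofinite : Filter (HeightOneSpectrum (𝓞 K) × Fin (n + 1))) ℂ) ∈ S :=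
      ⟨π', hπ', rfl⟩
    refine ⟨_, ⟨_, hγ, rfl⟩, ?_⟩
    have hout : (Quotient.out ((eigensystem π'.1 : HeightOneSpectrum (𝓞 K) × Fin (n + 1) → ℂ) :
        Germ (cofinite : Filter (HeightOneSpectrum (𝓞 K) × Fin (n + 1))) ℂ)) =ᶠ[cofinite]
        eigensystem π'.1 :=
      Filter.Germ.coe_eq.1 (Quotient.out_eq _)
    have hplaces : ∀ᶠ v : HeightOneSpectrum (𝓞 K) in cofinite, ∀ i : Fin (n + 1),
        σ (eigensystem π.1 (v, i)) = eigensystem π'.1 (v, i) := by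
      change ∀ᶠ v : HeightOneSpectrum (𝓞 K) in Filter.cofinite, _ at hconj
      filter_upwards [hconj] with v hv i
      obtain ⟨α, α', hα, hα', ht⟩ := hv
      rw [eigensystem_eq_of_hasSatakeParamAt π.1 hα, eigensystem_eq_of_hasSatakeParamAt π'.1 hα']
      exact (ht i (Nat.lt_succ_iff.1 i.2)).symm
    have hprod : ∀ᶠ p : HeightOneSpectrum (𝓞 K) × Fin (n + 1) in cofinite,
        σ (eigensystem π.1 p) = eigensystem π'.1 p := by
      have hfin := Filter.eventually_cofinite.1 hplaces
      refine Filter.eventually_cofinite.2 ((hfin.prod (Set.finite_univ (α := Fin (n + 1)))).subset ?_)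
      rintro ⟨v, i⟩ hp
      refine ⟨?_, Set.mem_univ _⟩
      intro hall
      exact hp (hall i)
    filter_upwards [hprod, hout] with p hp ho
    rw [ho]
    exact hp
  -- UNIF
  obtain ⟨E, hE, hmem⟩ := hU (eigensystem π.1) 𝒞 h𝒞 horbit
  refine ⟨E, hE, ?_⟩
  have hbad : {p : HeightOneSpectrum (𝓞 K) × Fin (n + 1) | ¬ eigensystem π.1 p ∈ E}.Finite :=
    Filter.eventually_cofinite.1 hmem
  have hbad1 := hbad.image Prod.fst
  refine Filter.eventually_cofinite.2 (hbad1.subset fun v hv => ?_)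
  by_contra hnot
  apply hv
  intro α hα i hi
  have hp : eigensystem π.1 (v, ⟨i, Nat.lt_succ_of_le hi⟩) ∈ E := by
    by_contra hne
    exact hnot ⟨(v, ⟨i, Nat.lt_succ_of_le hi⟩), hne, rfl⟩
  rw [eigensystem_eq_of_hasSatakeParamAt π.1 hα ⟨i, Nat.lt_succ_of_le hi⟩] at hp
  exact hp

/-! ## Card B (`semilinear-twist-finite-orbit`): the finite-orbit feeder with a UNIFORM exceptional set
plugs into the tree's existing theorem — no Baire needed on that line -/

/-- **(FUO)** finitely many `Aut(ℂ)`-conjugate eigensystems off ONE finite set of places (in print: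
`^σ` of the eigenclass of `π` lives in `H^q(S_{K(𝔫)}, Ṽ_{σλ})`, finite-dimensional, same level). -/
def FiniteUniformAutOrbit : Prop :=
  ∀ (n : ℕ) (K : Type) [Field K] [NumberField K] (hcpt : isCompact_glFiniteIntegralLevel n K)
    (π : CuspidalAutomorphicRepData n K hcpt), π.1.IsRegularAlgebraic →
    ∃ (S : Set (HeightOneSpectrum (𝓞 K))) (_ : S.Finite)
      (F : Finset (HeightOneSpectrum (𝓞 K) → ℕ → ℂ)),
      ∀ σ : ℂ ≃ₐ[ℚ] ℂ, ∃ f ∈ F, ∀ v ∉ S, ∀ α : Multiset ℂ,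
        π.1.HasSatakeParamAt v α → ∀ i ≤ n, σ (heckeEigenvalueOf n v α i) = f v i

/-- **First lemma of card B (PROVED):** (FUO) ⟹ the crux, by the in-tree
`heckeEigenvalue_mem_subfield_cofinite_of_finite_autOrbit` with `E = ℚ`. -/
theorem crux_of_finiteUniformAutOrbit (h : FiniteUniformAutOrbit) :
    Summit.Langlands.Langlands.Theses.IrreducibilityBySelfDuality.HeckeEigenvalueField := by
  intro n K _ _ hcpt π hπ
  obtain ⟨S, hS, F, horbit⟩ := h n K hcpt π hπ
  obtain ⟨E, hE, hmem⟩ := heckeEigenvalue_mem_subfield_cofinite_of_finite_autOrbit π.1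
    (⊥ : IntermediateField ℚ ℂ) hS F (fun σ _ => horbit σ)
  exact ⟨E, hE, hmem⟩

end Automorphic

/-! ## Sanity: the ambient instances the Baire step needs on `Gal(ℚ̄/ℚ)` are available -/

example : CompactSpace (Field.absoluteGaloisGroup ℚ) := inferInstance
example : T2Space (Field.absoluteGaloisGroup ℚ) := inferInstance
example : IsTopologicalGroup (Field.absoluteGaloisGroup ℚ) := inferInstance
example (H : Subgroup (Field.absoluteGaloisGroup ℚ)) (hH : IsOpen (H : Set (Field.absoluteGaloisGroup ℚ))) :
    FiniteDimensional ℚ (IntermediateField.fixedField H : IntermediateField ℚ (AlgebraicClosure ℚ)) :=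
  Literature.NumberTheory.GaloisRepresentations.finiteDimensional_fixedField_of_isOpen H hH

end Summit.Langlands.Langlands.Cruxes.HeckeEigenvalueField.BaireSketch
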